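import Literature.Topology.FourManifolds.KhLoopSquare
import Literature.Topology.FourManifolds.KhBigonHomotopy
import HarnessLib

/-!
# Gaussian elimination of a loop square

Sibling file of `KhComplex.lean`, continuing `KhLoopSquare.lean`: for a loop square `L` of a
Gauss diagram `K` all of whose cube edges are merges or splits, the two identity blocks
`A → P` and `Q → U` of the incidence matrix in the adapted basis `A ⊕ P ⊕ Q ⊕ U ⊕ R` are
cancelled by Gaussian elimination (`KhElim.elim`, Bar-Natan (2007), Lemma 4.2), exactly as for
the bigon in `KhBigonHomotopy.lean`, except that the blocks `R → P` and `A → R` need not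
vanish, so that the matrix left on the rest `R` carries the correction term of the elimination:

* `loopM L r r' = ⟨d r, r'⟩ - ∑ₓ ⟨d r, embO x X⟩ · edgeSign x f · ⟨d x, r'⟩`
  (`loopM`), and `loopMHtpy : MHtpy (K.incidence) (loopM L)` — **the Khovanov cochains of `K`
  retract by deformation onto the rest `R` with the differential `loopM`**
  (`redI_loopJ''` computes the reduced matrix);
* the retraction is graded for every admissible degree map (`isGraded_loopMHtpy`).

For the bigon the correction vanishes and `R ≅ C(G)` (`KhBigonHomotopy.lean`); for the triangle
of the third move it does not, and the two sides of the move are compared through their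
matrices `loopM` in `KhTriangle*.lean`. No named fact is introduced.

## References

* M. Khovanov, *A categorification of the Jones polynomial*, Duke Math. J. 101 (2000) 359–426,
  §5.3–5.4. [cite: Khovanov2000, §5.3]
* D. Bar-Natan, *Fast Khovanov homology computations*, J. Knot Theory Ramifications 16 (2007)
  243–255, Lemma 4.2. [cite: BarNatan2007, Lemma 4.2]
-/

open CategoryTheory Function Finset

noncomputable section

namespace Literature.Topology.FourManifolds

namespace GaussDiagram

namespace LoopSq

open KhElim

variable {K : GaussDiagram} (L : K.LoopSq) (o₀ : K.Arc) (ho₀ : L.InO o₀)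

/-- The index type of the adapted basis `A ⊕ P ⊕ Q ⊕ U ⊕ R` of a loop square. [folklore] -/
abbrev Idx : Type := L.XA ⊕ (L.XA ⊕ (L.XA ⊕ (L.XA ⊕ L.XR)))

section Ring

variable {R : Type} [CommRing R] (hR tR : R)

/-- The incidence matrix in the adapted basis. [folklore] -/
def loopJ (a b : L.Idx) : R := K.incidence R hR tR (L.embSum a) (L.embSum b)

/-- **The Koszul signs used to rescale the adapted basis**: on `A` the sign of the edge at `f`,
on `Q` the sign of the edge at `g`, `1` elsewhere. [folklore] -/
def loopU : L.Idx → R :=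
  Sum.elim (fun x ↦ (edgeSign x.1.state L.f : R))
    (Sum.elim (fun _ ↦ 1) (Sum.elim (fun x ↦ (edgeSign (L.stO x.1.state) L.g : R)) (fun _ ↦ 1)))

/-- The rescaling signs are self-inverse. [folklore] -/
theorem loopU_mul_self (a : L.Idx) : L.loopU (R := R) a * L.loopU a = 1 := by
  rcases a with x | x | x | r
  · exact Transfer.edgeSign_mul_self _ _
  · exact one_mul 1
  · exact Transfer.edgeSign_mul_self _ _
  · exact one_mul 1

/-- **The rescaled incidence matrix in the adapted basis.** [folklore] -/
def loopJ' (a b : L.Idx) : R := L.loopU a * L.loopJ hR tR a b * L.loopU b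

variable (hms : ∀ (τ : K.State) (k : Fin K.n), τ k = false → K.IsMergeAt τ k ∨ K.IsSplitAt τ k)

include hms ho₀ in
/-- `d² = 0` in the adapted basis (from merge-or-split). [folklore] -/
theorem sum_loopJ_mul (a z : L.Idx) : ∑ y, L.loopJ hR tR a y * L.loopJ hR tR y z = 0 := by
  unfold loopJ
  rw [show (∑ y, K.incidence R hR tR (L.embSum a) (L.embSum y) * K.incidence R hR tR (L.embSum y) (L.embSum z)) =
      ∑ y, K.incidence R hR tR (L.embSum a) (L.loopESEquiv o₀ ho₀ y) *
        K.incidence R hR tR (L.loopESEquiv o₀ ho₀ y) (L.embSum z) from rfl,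
    (L.loopESEquiv o₀ ho₀).sum_comp (fun t ↦ K.incidence R hR tR (L.embSum a) t *
      K.incidence R hR tR t (L.embSum z))]
  exact sum_incidence_mul_incidence_eq_zero hms hR tR _ _

include hms ho₀ in
/-- `d² = 0` for the rescaled matrix. [folklore] -/
theorem sum_loopJ'_mul (a z : L.Idx) : ∑ y, L.loopJ' hR tR a y * L.loopJ' hR tR y z = 0 := by
  unfold loopJ'
  have key : ∀ y, L.loopU a * L.loopJ hR tR a y * L.loopU y * (L.loopU y * L.loopJ hR tR y z * L.loopU z) =
      L.loopU a * L.loopU z * (L.loopJ hR tR a y * L.loopJ hR tR y z) := by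
    intro y
    have := L.loopU_mul_self (R := R) y
    linear_combination (L.loopU a * L.loopU z * L.loopJ hR tR a y * L.loopJ hR tR y z) * this
  simp only [key, ← Finset.mul_sum, L.sum_loopJ_mul o₀ ho₀ hR tR hms, mul_zero]

/-- **The block `A → P` of the rescaled matrix is the identity.** [folklore] -/
theorem loopJ'_AP (x x' : L.XA) : L.loopJ' hR tR (.inl x) (.inr (.inl x')) = if x = x' then 1 else 0 := by
  unfold loopJ' loopJ loopU
  simp only [Sum.elim_inl, Sum.elim_inr, embSum_inl, embSum_inr_inl, mul_one]
  rw [incidence_embA_embP]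
  split_ifs
  · exact Transfer.edgeSign_mul_self _ _
  · exact mul_zero _

include ho₀ in
/-- The block `Q → P` of the rescaled matrix vanishes. [folklore] -/
theorem loopJ'_QP (q x : L.XA) : L.loopJ' hR tR (.inr (.inr (.inl q))) (.inr (.inl x)) = 0 := by
  unfold loopJ' loopJ
  simp only [embSum_inr_inr_inl, embSum_inr_inl]
  rw [incidence_eq_zero_of_label_O_ne o₀ ho₀ hR tR (embO_cond q false) (embO_cond x true)
    (by rw [embO_label_of_inO q false ho₀, embO_label_of_inO x true ho₀]; decide), mul_zero, zero_mul]

/-- The block `U → P` of the rescaled matrix vanishes. [folklore] -/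
theorem loopJ'_UP (q x : L.XA) : L.loopJ' hR tR (.inr (.inr (.inr (.inl q)))) (.inr (.inl x)) = 0 := by
  unfold loopJ' loopJ
  simp only [embSum_inr_inr_inr_inl, embSum_inr_inl]
  rw [incidence_eq_zero_of_state_true_false hR tR L.g (embU_cond q).2.1 (embO_cond x true).2.1,
    mul_zero, zero_mul]

variable (hPm : ∀ (σ : K.State) (j : Fin K.n), L.P σ → L.P (Function.update σ j true))

include hPm in
/-- With a monotone condition `P`, no cube edge leaves the sectors `P ∪ Q` into the rest. [folklore] -/
theorem incidence_embO_XR (x : L.XA) (o : Bool) (r : L.XR) : K.incidence R hR tR (embO x o) r.1 = 0 := by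
  apply K.incidence_of_not_flip R hR tR
  rintro ⟨j, -, hs⟩
  apply r.2
  refine ⟨?_, fun h ↦ ?_⟩
  · rw [hs]; exact hPm _ _ (embO_cond x o).2.2
  · exfalso
    have h1 := congrFun hs L.f
    rw [h] at h1
    by_cases hj : j = L.f
    · rw [hj, Function.update_self] at h1
      exact Bool.noConfusion h1
    · rw [Function.update_of_ne (fun h ↦ hj h.symm), (embO_cond x o).1] at h1
      exact Bool.noConfusion h1

include hPm in
/-- The block `Q → R` of the rescaled matrix vanishes. [folklore] -/
theorem loopJ'_QR (q : L.XA) (r : L.XR) : L.loopJ' hR tR (.inr (.inr (.inl q))) (.inr (.inr (.inr (.inr r)))) = 0 := by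
  unfold loopJ' loopJ
  simp only [embSum_inr_inr_inl, embSum_inr_inr_inr_inr]
  rw [L.incidence_embO_XR hR tR hPm, mul_zero, zero_mul]

/-- **The matrix after the first cancellation** on `Q ⊕ U ⊕ R`. [folklore] -/
def loopJ'' (r r' : L.XA ⊕ (L.XA ⊕ L.XR)) : R := redI (L.loopJ' hR tR) r r'

include hms ho₀ in
/-- `d² = 0` after the first cancellation. [folklore] -/
theorem sum_loopJ''_mul (a z : L.XA ⊕ (L.XA ⊕ L.XR)) : ∑ y, L.loopJ'' hR tR a y * L.loopJ'' hR tR y z = 0 :=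
  sum_redI_mul_redI (L.sum_loopJ'_mul o₀ ho₀ hR tR hms) (L.loopJ'_AP hR tR) a z

include ho₀ in
/-- The rows of `Q` are unchanged by the first cancellation. [folklore] -/
theorem loopJ''_Q (x : L.XA) (r' : L.XA ⊕ (L.XA ⊕ L.XR)) :
    L.loopJ'' hR tR (.inl x) r' = L.loopJ' hR tR (.inr (.inr (.inl x))) (.inr (.inr r')) := by
  unfold loopJ'' redI
  simp only [L.loopJ'_QP o₀ ho₀, zero_mul, Finset.sum_const_zero, sub_zero]

include ho₀ in
/-- **The block `Q → U` after the first cancellation is the identity.** [folklore] -/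
theorem loopJ''_QU (x x' : L.XA) : L.loopJ'' hR tR (.inl x) (.inr (.inl x')) = if x = x' then 1 else 0 := by
  rw [L.loopJ''_Q o₀ ho₀]
  unfold loopJ' loopJ loopU
  simp only [Sum.elim_inl, Sum.elim_inr, embSum_inr_inr_inl, embSum_inr_inr_inr_inl, mul_one]
  rw [incidence_embQ_embU]
  split_ifs
  · exact Transfer.edgeSign_mul_self _ _
  · exact mul_zero _

include ho₀ hPm in
/-- The block `Q → R` after the first cancellation vanishes. [folklore] -/
theorem loopJ''_QR (x : L.XA) (r : L.XR) : L.loopJ'' hR tR (.inl x) (.inr (.inr r)) = 0 := by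
  rw [L.loopJ''_Q o₀ ho₀]
  exact L.loopJ'_QR hR tR hPm x r

/-- **The differential left on the rest after both cancellations**:
`⟨d r, r'⟩ - ∑ₓ ⟨d r, embO x X⟩ · edgeSign_f(x) · ⟨d x, r'⟩`. Bar-Natan (2007), Lemma 4.2
(the term `-C A⁻¹ B` of Gaussian elimination). [cite: BarNatan2007, Lemma 4.2] -/
def loopM (r r' : L.XR) : R :=
  K.incidence R hR tR r.1 r'.1 -
    ∑ x : L.XA, K.incidence R hR tR r.1 (embO x true) * (edgeSign x.1.state L.f : R) * K.incidence R hR tR x.1 r'.1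

include ho₀ hPm in
/-- **The matrix after both cancellations is `loopM`.** [folklore] -/
theorem redI_loopJ'' (r r' : L.XR) : redI (L.loopJ'' hR tR) r r' = L.loopM hR tR r r' := by
  unfold redI
  simp only [L.loopJ''_QR o₀ ho₀ hR tR hPm, mul_zero, Finset.sum_const_zero, sub_zero]
  unfold loopJ'' redI loopM loopJ' loopJ loopU
  simp only [Sum.elim_inl, Sum.elim_inr, embSum_inr_inr_inr_inr, embSum_inr_inl, embSum_inl, one_mul, mul_one,
    mul_assoc]

/-- **The Khovanov cochains of `K` retract by deformation onto the rest with the differential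
`loopM`**: relabel to the adapted basis, rescale by the Koszul signs, cancel `A → P`, then
`Q → U`. Khovanov (2000), §5.3–5.4; Bar-Natan (2007), Lemma 4.2. [cite: Khovanov2000, §5.3] -/
def loopMHtpy : MHtpy (K.incidence R hR tR) (L.loopM hR tR) :=
  (MHtpy.ofEquiv (L.loopESEquiv o₀ ho₀) (K.incidence R hR tR) (L.loopJ hR tR) (fun _ _ ↦ rfl)).trans
    ((MHtpy.rescale (L.loopJ hR tR) L.loopU L.loopU_mul_self).trans
      ((KhElim.elim (L.sum_loopJ'_mul o₀ ho₀ hR tR hms) (L.loopJ'_AP hR tR)).trans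
        ((KhElim.elim (L.sum_loopJ''_mul o₀ ho₀ hR tR hms) (L.loopJ''_QU o₀ ho₀ hR tR)).congrRight
          (L.redI_loopJ'' o₀ ho₀ hR tR hPm))))

/-! ### Degrees -/

/-- A degree map on enhanced states is **admissible** if nonzero incidence numbers raise it by
`(1, 0)`, both over `R` and over `ℤ` at `h = t = 0`. [folklore] -/
structure AdmissibleDeg (d : K.EnhancedState → ℤ × ℤ) : Prop where
  /-- Over `R`. -/
  ringDeg : ∀ a b, K.incidence R hR tR a b ≠ 0 → d b = d a + (1, 0)
  /-- Over `ℤ` at `h = t = 0`. -/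
  intDeg : ∀ a b, K.incidence ℤ 0 0 a b ≠ 0 → d b = d a + (1, 0)

variable {hR tR}

/-- Nonzero entries of the matrix after the first cancellation raise admissible degrees. [folklore] -/
theorem deg_of_loopJ''_ne_zero {d : K.EnhancedState → ℤ × ℤ} (hd : AdmissibleDeg hR tR d)
    (a b : L.XA ⊕ (L.XA ⊕ L.XR)) (hab : L.loopJ'' hR tR a b ≠ 0) :
    d (L.embSum (.inr (.inr b))) = d (L.embSum (.inr (.inr a))) + (1, 0) := by
  have hI : ∀ a b, L.loopJ' hR tR a b ≠ 0 → d (L.embSum b) = d (L.embSum a) + (1, 0) := by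
    intro a b hab
    apply hd.ringDeg
    intro h0
    apply hab
    unfold loopJ' loopJ
    rw [h0, mul_zero, zero_mul]
  unfold loopJ'' redI at hab
  by_cases h1 : L.loopJ' hR tR (.inr (.inr a)) (.inr (.inr b)) ≠ 0
  · exact hI _ _ h1
  · rw [not_ne_iff] at h1
    rw [h1, zero_sub, neg_ne_zero] at hab
    obtain ⟨x, -, hx⟩ := Finset.exists_ne_zero_of_sum_ne_zero hab
    have h2 : L.loopJ' hR tR (.inr (.inr a)) (.inr (.inl x)) ≠ 0 := left_ne_zero_of_mul hx
    have h3 : L.loopJ' hR tR (.inl x) (.inr (.inr b)) ≠ 0 := right_ne_zero_of_mul hx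
    have e2 := hI _ _ h2; have e3 := hI _ _ h3
    have e4 : d (L.embSum (.inr (.inl x))) = d (L.embSum (.inl x)) + (1, 0) := by
      simp only [embSum_inr_inl, embSum_inl]
      exact hd.intDeg _ _ (incidence_embA_embP_self_ne_zero x)
    rw [e3, ← e4, e2]

include hms in
/-- **The retraction onto the rest is graded** for every admissible degree map. [folklore] -/
theorem isGraded_loopMHtpy {d : K.EnhancedState → ℤ × ℤ} (hd : AdmissibleDeg hR tR d) :
    (L.loopMHtpy o₀ ho₀ hR tR hms hPm).IsGraded d (fun r ↦ d r.1) := by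
  unfold loopMHtpy
  refine MHtpy.IsGraded.trans (MHtpy.IsGraded.ofEquiv _ _ _ _ (dT := fun a ↦ d (L.embSum a)) (fun _ ↦ rfl)) ?_
  refine MHtpy.IsGraded.trans (MHtpy.IsGraded.rescale _ _ _ _) ?_
  have hI : ∀ a b, L.loopJ' hR tR a b ≠ 0 → d (L.embSum b) = d (L.embSum a) + (1, 0) := by
    intro a b hab
    apply hd.ringDeg
    intro h0
    apply hab
    unfold loopJ' loopJ
    rw [h0, mul_zero, zero_mul]
  refine MHtpy.IsGraded.trans (MHtpy.IsGraded.elim _ _ hI ?_) ?_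
  · intro x
    simp only [embSum_inr_inl, embSum_inl]
    exact hd.intDeg _ _ (incidence_embA_embP_self_ne_zero x)
  · refine MHtpy.IsGraded.congrRight _ (MHtpy.IsGraded.elim _ _ (fun a b hab ↦ L.deg_of_loopJ''_ne_zero hd a b hab) ?_)
    intro x
    simp only [embSum_inr_inr_inl, embSum_inr_inr_inr_inl]
    exact hd.intDeg _ _ (incidence_embQ_embU_self_ne_zero x)

variable (hR tR)

/-- The homological degree (alone) is an admissible degree map. [folklore] -/
theorem admissibleDeg_homDegree : AdmissibleDeg hR tR (fun s : K.EnhancedState ↦ ((homDegree s : ℤ), (0 : ℤ))) where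
  ringDeg a b h0 := by rw [Prod.mk_add_mk, add_zero, homDegree_eq_of_incidence_ne_zero h0]
  intDeg a b h0 := by rw [Prod.mk_add_mk, add_zero, homDegree_eq_of_incidence_ne_zero h0]

/-- The bidegree is an admissible degree map at `h = t = 0` over `ℤ`. [folklore] -/
theorem admissibleDeg_bideg : AdmissibleDeg (0 : ℤ) 0 (fun s : K.EnhancedState ↦ (homDegree s, qDegree s)) where
  ringDeg a b h0 := by
    rw [Prod.mk_add_mk, add_zero, homDegree_eq_of_incidence_ne_zero h0, qDegree_eq_of_incidence_ne_zero_holds h0]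
  intDeg a b h0 := by
    rw [Prod.mk_add_mk, add_zero, homDegree_eq_of_incidence_ne_zero h0, qDegree_eq_of_incidence_ne_zero_holds h0]

end Ring

end LoopSq

end GaussDiagram

end Literature.Topology.FourManifolds
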